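import Summits.NavierStokesRegularity.NavierStokesRegularity.Theorems.QuantisedSymmetryPolyhedralTruncationBridge
import Summits.NavierStokesRegularity.NavierStokesRegularity.Theorems.QuantisedSymmetryPolyhedralDssProfileExistsDominatesBlowupProfile
import Summits.AnomalousDissipation.AnomalousDissipation.Theorems.SoloBlindNewtonClose
import HarnessLib

/-!
# Strategist sketch s20-g3 (crux `PolyhedralDssProfileExists`, stmt-NavierStokesRegularity-1404)

Companion to `STRATEGY-CENSUS-s20.md` (family `s`, gen 3, independent census). Kernel-checked
facts used by the census:

1. `crux_decides` — the crux ALONE proves `¬ NavierStokesRegularity`: the other two binders of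
   the route's `closes` are tree theorems (`quantisedSymmetry_polyhedralTruncationBridge_proof`,
   `ClayUniqueness_holds`). Hence any replacement intermediate that keeps the route deciding must
   itself prove `¬ NavierStokesRegularity`.
2. The WEAKER-INTERMEDIATE ladder below the crux — drop the symmetry (`DssProfileExists`), then
   allow a rotation (`RdssProfileExists`) — still decides `¬ NavierStokesRegularity` by tree
   theorems (`dss_decides`, `rdss_decides`), and its rungs are literally other routes' cruxes
   (`dss_iff_exists_not_typeIDSSLiouville`, `blowupTypeIDssProfile_of_dss`: Blowup #5, stmt-0155;
   `RdssProfileExists` = antecedent of FilamentSkeletonRss.RdssProfileTruncation, stmt-11289).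
3. `quadratic_close_nontrivial` — the proved ASSEMBLY of the only honest typed split (computer-
   assisted: certificate ∧ closing lemma ⇒ nontrivial zero of `U − B(U,U)`), an instance of the
   tree's `newton_quadratic_close`; the census explains why the certificate piece carries the
   whole crux.
4. `killSwitch_split` — the dichotomy split through the route's kill switch is modus ponens and
   its second piece has no plan (census §Decomposition).
-/

set_option linter.dupNamespace false

namespace Summit.NavierStokesRegularity.NavierStokesRegularity.Cruxes.PolyhedralDssProfileExists.S20g3

open MeasureTheory
open Literature.Analysis.FluidPDE
open _root_.Summit.NavierStokesRegularity.NavierStokesRegularity.Theses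

/-! ## 1. The crux alone decides the negative summit -/

/-- X⁻ ⊢ ¬S with no open hypothesis: the bridge (stmt-11331) and Clay uniqueness (stmt-0153) are
tree theorems. -/
theorem crux_decides (hX : QuantisedSymmetry.PolyhedralDssProfileExists) :
    ¬ _root_.NavierStokesRegularity :=
  QuantisedSymmetry.closes hX
    _root_.Summit.NavierStokesRegularity.NavierStokesRegularity.Theorems.quantisedSymmetry_polyhedralTruncationBridge_proof
    QuantisedSymmetry.ClayUniqueness_holds

/-! ## 2. The weaker-intermediate ladder (every rung still decides `¬S`) -/

/-- W₁: the crux with the polyhedral symmetry clauses DROPPED — a nontrivial Type-I `c`-DSS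
ancient mild solution for some `c > 1`. -/
def DssProfileExists : Prop :=
  ∃ c : ℝ, 1 < c ∧ ∃ u : ℝ → EuclideanSpace ℝ (Fin 3) → EuclideanSpace ℝ (Fin 3),
    IsAncientMildSolution 1 u ∧ (∀ t < 0, AEStronglyMeasurable (u t) volume) ∧
      IsDiscretelySelfSimilar c u ∧ (∃ C₀ : ℝ, HasTypeIDecay C₀ u) ∧ ¬ (∀ t < 0, u t =ᵐ[volume] 0)

/-- W₂: rotated version — literally the antecedent of `FilamentSkeletonRss.RdssProfileTruncation`
(stmt-11289, proved bridge). -/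
def RdssProfileExists : Prop :=
  ∃ (c : ℝ) (R : EuclideanSpace ℝ (Fin 3) ≃ₗᵢ[ℝ] EuclideanSpace ℝ (Fin 3))
    (u : ℝ → EuclideanSpace ℝ (Fin 3) → EuclideanSpace ℝ (Fin 3)),
    1 < c ∧ IsAncientMildSolution 1 u ∧ (∀ t < 0, AEStronglyMeasurable (u t) volume) ∧
      IsRotatedDSS c R u ∧ (∃ C₀ : ℝ, HasTypeIDecay C₀ u) ∧ ¬ (∀ t < 0, u t =ᵐ[volume] 0)

theorem dss_of_crux (hX : QuantisedSymmetry.PolyhedralDssProfileExists) : DssProfileExists := by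
  obtain ⟨G, -, -, -, c, hc, u, hanc, hmeas, hdss, hdec, -, hnt⟩ := hX
  exact ⟨c, hc, u, hanc, hmeas, hdss, hdec, hnt⟩

theorem rdss_of_dss (h : DssProfileExists) : RdssProfileExists := by
  obtain ⟨c, hc, u, hanc, hmeas, hdss, hdec, hnt⟩ := h
  exact ⟨c, LinearIsometryEquiv.refl ℝ _, u, hc, hanc, hmeas, isRotatedDSS_refl_iff.mpr hdss, hdec, hnt⟩

/-- W₁ is exactly the first disjunct of Blowup's crux #5: `∃ c > 1, ¬ TypeIDSSLiouville c`. -/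
theorem dss_iff_exists_not_typeIDSSLiouville :
    DssProfileExists ↔ ∃ c : ℝ, 1 < c ∧ ¬ TypeIDSSLiouville c := by
  constructor
  · rintro ⟨c, hc, u, hanc, hmeas, hdss, hdec, hnt⟩
    exact ⟨c, hc, fun hL => hnt (hL hc u hanc hmeas hdss hdec)⟩
  · rintro ⟨c, hc, hL⟩
    by_contra hne
    refine hL fun _ u hanc hmeas hdss hdec => ?_
    by_contra hnt
    exact hne ⟨c, hc, u, hanc, hmeas, hdss, hdec, hnt⟩

theorem blowupTypeIDssProfile_of_dss (h : DssProfileExists) : Blowup.BlowupTypeIDssProfile := by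
  obtain ⟨c, -, hc⟩ := dss_iff_exists_not_typeIDSSLiouville.mp h
  dsimp only [Blowup.BlowupTypeIDssProfile]
  exact fun hL => hc (hL c).1

/-- W₂ (hence W₁, hence X⁻) decides `¬S` through the PROVED rotated truncation bridge (stmt-11289)
and Blowup's `closes` with the PROVED Clay uniqueness (stmt-0153): no rung of the ladder is short
of the (negative) summit. -/
theorem rdss_decides (h : RdssProfileExists) : ¬ _root_.NavierStokesRegularity :=
  Blowup.closes
    (_root_.Summit.NavierStokesRegularity.NavierStokesRegularity.Theorems.filamentSkeletonRss_rdssProfileTruncation_proof h)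
    Blowup.BlowupClayUniqueness_holds

theorem dss_decides (h : DssProfileExists) : ¬ _root_.NavierStokesRegularity :=
  rdss_decides (rdss_of_dss h)

/-! ## 3. Decomposition: the computer-assisted split and its proved assembly

Abstract frame of the cell / ancient-Duhamel formulation `U = B(U,U)` on a real Banach space `E`
(concretely: `S`-periodic, `G`-equivariant, divergence-free fields with finite Type-I weighted sup
norm; `B` = the ancient Oseen–Duhamel bilinear form — census §Decomposition). Piece A (certificate):
an approximate solution `U₀`, a bounded right inverse `Ainv` of the linearisation with
`‖Ainv‖ ≤ M`, residual `≤ r`, `8 M² ‖B‖ r ≤ 1`, and `2 M r < ‖U₀‖`. Piece K (closing): Newton —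
in tree as `newton_quadratic_close`. Assembly: a NONTRIVIAL exact solution. -/

section CAP

variable {E : Type*} [NormedAddCommGroup E] [NormedSpace ℝ E] [CompleteSpace E]

/-- Proved assembly of the CAP split: certificate ⇒ nontrivial zero of `U − B(U,U)`. -/
theorem quadratic_close_nontrivial (B : E →L[ℝ] E →L[ℝ] E) (U₀ : E) (Ainv : E →L[ℝ] E)
    (hA : ∀ y, Ainv y - B U₀ (Ainv y) - B (Ainv y) U₀ = y) {M r : ℝ} (hM0 : 0 ≤ M) (hr0 : 0 ≤ r)
    (hM : ‖Ainv‖ ≤ M) (hres : ‖U₀ - B U₀ U₀‖ ≤ r) (hsmall : 8 * M ^ 2 * ‖B‖ * r ≤ 1)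
    (hbig : 2 * M * r < ‖U₀‖) :
    ∃ U : E, U = B U U ∧ U ≠ 0 ∧ ‖U - U₀‖ ≤ 2 * M * r := by
  have hN : ∀ v w : E, ‖v‖ ≤ 2 * M * r → ‖w‖ ≤ 2 * M * r →
      ‖(-(B v v)) - (-(B w w))‖ ≤ ‖B‖ * (‖v‖ + ‖w‖) * ‖v - w‖ := by
    intro v w _ _
    have h1 : (-(B v v)) - (-(B w w)) = -(B v (v - w) + B (v - w) w) := by
      simp only [map_sub, ContinuousLinearMap.coe_sub', Pi.sub_apply]; abel
    rw [h1, norm_neg]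
    calc ‖B v (v - w) + B (v - w) w‖ ≤ ‖B v (v - w)‖ + ‖B (v - w) w‖ := norm_add_le _ _
      _ ≤ ‖B‖ * ‖v‖ * ‖v - w‖ + ‖B‖ * ‖v - w‖ * ‖w‖ :=
          add_le_add (B.le_opNorm₂ v (v - w)) (B.le_opNorm₂ (v - w) w)
      _ = ‖B‖ * (‖v‖ + ‖w‖) * ‖v - w‖ := by ring
  obtain ⟨v, hv, hsol⟩ :=
    _root_.Summit.AnomalousDissipation.AnomalousDissipation.Theorems.newton_quadratic_close
      (U₀ - B U₀ U₀) (fun v => v - B U₀ v - B v U₀) Ainv (fun v => -(B v v)) hA hM0 hr0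
      (norm_nonneg B) hM hres (by simp) hN (by simpa [mul_comm, mul_left_comm, mul_assoc] using hsmall)
  refine ⟨U₀ + v, ?_, ?_, by simpa using hv⟩
  · -- expand `B (U₀+v) (U₀+v)` and use the solved equation
    have hexp : B (U₀ + v) (U₀ + v) = B U₀ U₀ + B U₀ v + B v U₀ + B v v := by
      simp only [map_add, ContinuousLinearMap.coe_add', Pi.add_apply]; abel
    rw [hexp]
    have : U₀ - B U₀ U₀ + (v - B U₀ v - B v U₀) + -(B v v) = 0 := hsol
    rw [← sub_eq_zero]
    rw [← this]
    abel
  · intro h0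
    have : ‖U₀‖ = ‖v‖ := by
      have : U₀ = -v := by rwa [add_eq_zero_iff_eq_neg] at h0
      rw [this, norm_neg]
    linarith

end CAP

/-! ## 4. The kill-switch dichotomy split is modus ponens (no plan for its second piece) -/

theorem killSwitch_split (h₁ : ¬ QuantisedSymmetry.PolyhedralTypeILiouville)
    (h₂ : ¬ QuantisedSymmetry.PolyhedralTypeILiouville → QuantisedSymmetry.PolyhedralDssProfileExists) :
    QuantisedSymmetry.PolyhedralDssProfileExists := h₂ h₁

end Summit.NavierStokesRegularity.NavierStokesRegularity.Cruxes.PolyhedralDssProfileExists.S20g3
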